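import Summits.RiemannHypothesis.RiemannHypothesis.Theses.SpectralTrace
import Summits.RiemannHypothesis.RiemannHypothesis.Theorems.WindowTraceArch.Negative.UnitMass
import Summits.RiemannHypothesis.RiemannHypothesis.Theorems.WindowTraceArch.Negative.ComplexSpectrum
import Summits.RiemannHypothesis.RiemannHypothesis.Theorems.WindowTraceArch.Negative.FiniteSpectrum
import Literature.NumberTheory.LFunctions.WeilCriterionProofs
import Literature.NumberTheory.LFunctions.SimpleZeros
import HarnessLib

/-!
# `SpectralIsHpSpectrum` — a refutation of the crux would prove RH; load-bearing hypotheses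

Negative-lane lemmas for the crux `stmt-RiemannHypothesis-0195`
(`Summit.RiemannHypothesis.RiemannHypothesis.Theses.SpectralTrace.SpectralIsHpSpectrum`: every real
family `γ` with `HasSum (i ↦ ĝ(1/2+iγ_i)) (W g)` for all Weil tests `g` has, over every `z`, fibre
count `{i | 1/2 + iγ_i = z}.encard` equal to the multiplicity of `z` as a non-trivial zero of `ζ`),
recorded by the standing disprover (`Cruxes/SpectralIsHpSpectrum/Disproof.lean`).

* `riemannHypothesis_of_trace` : the HYPOTHESIS of the crux, for any one family, proves RH
  (Bochner form `HasSum |ĝ(1/2+iγ_i)|² (Re Q g)` from `hasSum_norm_sq_of_windowTrace`, then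
  `weil_criterion_holds`).
* `riemannHypothesis_of_not_spectralIsHpSpectrum` : hence `¬ crux → RH` — no unconditional
  refutation of the crux can exist short of a proof of RH (and under RH the crux is the classical
  Fourier-uniqueness rigidity).
* `nontrivialZeros_nonempty` : `ζ` has a non-trivial zero, from the Weil machinery alone
  (`hasSum_weilMellin_zeros` + `not_windowTrace_finite`).
* `spectralIsHpSpectrum_false_without_value` : the crux with `HasSum … (W g)` weakened to
  `Summable` is FALSE (witness: the empty family) — the value `W g` is load-bearing.
* `spectralIsHpSpectrum_false_on_window_of_nonpos` : the crux with tests restricted to a window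
  `[-A, A]`, `A ≤ 0`, is FALSE (witness: `ℕ ↦ 0`, infinite fibre) — "all tests" cannot be
  weakened to a degenerate window.
* `spectralIsHpSpectrumAllZeros_iff_not_riemannHypothesis` : the variant counting ALL zeros of `ζ`
  on the right-hand side is equivalent to `¬ RH` (the trivial zero `-2` has empty fibre).
-/

noncomputable section

open Complex Set MeasureTheory Filter

namespace Summit.RiemannHypothesis.RiemannHypothesis.Theorems.SpectralIsHpSpectrum.Negative

open Literature.NumberTheory.LFunctions
open Summit.RiemannHypothesis.RiemannHypothesis.Theorems.WindowTraceArch.Negative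

/-! ### The hypothesis proves RH -/

/-- A compactly supported function is supported in some `[-R, R]`, `R > 0`. [folklore] -/
theorem exists_tsupport_subset_Icc {g : ℝ → ℂ} (hg : HasCompactSupport g) :
    ∃ R : ℝ, 0 < R ∧ tsupport g ⊆ Icc (-R) R := by
  obtain ⟨R, hR⟩ := hg.isCompact.isBounded.subset_closedBall 0
  refine ⟨max R 1, by positivity, hR.trans fun x hx => ?_⟩
  rw [Metric.mem_closedBall, dist_zero_right, Real.norm_eq_abs] at hx
  have h1 := le_max_left R 1
  exact ⟨by linarith [neg_abs_le x], by linarith [le_abs_self x]⟩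

/-- **Bochner form of a full trace**: if `γ` reproduces `W` on all Weil tests then
`HasSum (i ↦ |ĝ(1/2+iγ_i)|²) (Re Q(g))` for every Weil test `g`. [folklore] -/
theorem hasSum_norm_sq_of_trace {ι : Type*} {γ : ι → ℝ}
    (h : ∀ g : ℝ → ℂ, IsWeilTest g →
      HasSum (fun i => weilMellin g (1 / 2 + (γ i : ℂ) * I)) (weilFunctional g))
    {g : ℝ → ℂ} (hg : IsWeilTest g) :
    HasSum (fun i => ‖weilMellin g (1 / 2 + (γ i : ℂ) * I)‖ ^ 2) (weilQuadratic g).re := by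
  obtain ⟨R, -, hR⟩ := exists_tsupport_subset_Icc hg.2
  refine hasSum_norm_sq_of_windowTrace (A := 2 * R) (fun k hk _ => h k hk) hg ?_
  rwa [show (2 * R) / 2 = R by ring]

/-- **The hypothesis of the crux proves RH**: a real family reproducing `W` on all Weil tests
gives Weil positivity, hence RH by Weil's criterion (`weil_criterion_holds`). [folklore] -/
theorem riemannHypothesis_of_trace {ι : Type*} {γ : ι → ℝ}
    (h : ∀ g : ℝ → ℂ, IsWeilTest g →
      HasSum (fun i => weilMellin g (1 / 2 + (γ i : ℂ) * I)) (weilFunctional g)) :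
    _root_.RiemannHypothesis :=
  (show _root_.RiemannHypothesis ↔ WeilPositivity from weil_criterion_holds).2
    fun _ hg => (hasSum_norm_sq_of_trace h hg).nonneg fun _ => by positivity

/-- **Barrier: a refutation of the crux `SpectralIsHpSpectrum` is a proof of RH** (if RH fails,
no family satisfies the hypothesis and the crux holds vacuously). [folklore] -/
theorem riemannHypothesis_of_not_spectralIsHpSpectrum
    (h : ¬ Summit.RiemannHypothesis.RiemannHypothesis.Theses.SpectralTrace.SpectralIsHpSpectrum) :
    _root_.RiemannHypothesis := by
  by_contra hRH
  exact h fun _ _ hγ => absurd (riemannHypothesis_of_trace hγ) hRH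

/-! ### Bookkeeping on the right-hand side -/

/-- At a zero `ρ ≠ 1` of `ζ` the crux's multiplicity `(analyticOrderNatAt ζ ρ : ℕ∞)` is not `0`
(finiteness of the order: `analyticOrderAt_riemannZeta_ne_top`, `SimpleZeros.lean`). [folklore] -/
theorem cast_analyticOrderNatAt_ne_zero {ρ : ℂ} (h1 : ρ ≠ 1) (hζ : riemannZeta ρ = 0) :
    (analyticOrderNatAt riemannZeta ρ : ℕ∞) ≠ 0 := by
  rw [Nat.cast_analyticOrderNatAt (analyticOrderAt_riemannZeta_ne_top h1), analyticOrderAt_ne_zero]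
  exact ⟨analyticOn_riemannZeta ρ h1, hζ⟩

/-- The right-hand side of the crux is never `⊤`. [folklore] -/
theorem indicator_ne_top (z : ℂ) :
    ZetaZeros.riemannZetaNontrivialZeros.indicator
      (fun w => (analyticOrderNatAt riemannZeta w : ℕ∞)) z ≠ ⊤ := by
  by_cases hz : z ∈ ZetaZeros.riemannZetaNontrivialZeros
  · rw [Set.indicator_of_mem hz]
    exact ENat.coe_ne_top _
  · rw [Set.indicator_of_notMem hz]
    exact ENat.coe_ne_top 0

/-! ### Load-bearing: the VALUE of the trace -/

/-- **`ζ` has a non-trivial zero**, from the Weil machinery alone: otherwise the complex zero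
spectrum of `hasSum_weilMellin_zeros` is empty, `W ≡ 0` on Weil tests, and the EMPTY real family
would reproduce `W` on the window `[-1, 1]` — excluded by `not_windowTrace_finite`. [folklore] -/
theorem nontrivialZeros_nonempty : ZetaZeros.riemannZetaNontrivialZeros.Nonempty := by
  by_contra h
  have hE : IsEmpty (Σ ρ : ZetaZeros.riemannZetaNontrivialZeros,
      Fin (riemannZetaZeroOrder (ρ : ℂ)).toNat) :=
    ⟨fun p => h ⟨(p.1 : ℂ), p.1.2⟩⟩
  have hW : ∀ g : ℝ → ℂ, IsWeilTest g → weilFunctional g = 0 := fun g hg =>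
    (hasSum_weilMellin_zeros hg).unique hasSum_empty
  refine not_windowTrace_finite one_pos ⟨PEmpty, inferInstance, fun i => i.elim, fun g hg _ => ?_⟩
  rw [hW g hg]
  exact hasSum_empty

/-- **FALSE WITHOUT THE VALUE.** Weakening `HasSum … (W g)` to `Summable` in the hypothesis of
`SpectralIsHpSpectrum` gives a false statement: the empty family is vacuously summable, its fibres
are empty, but a non-trivial zero has multiplicity `≥ 1`. [folklore] -/
theorem spectralIsHpSpectrum_false_without_value :
    ¬ ∀ (ι : Type) (γ : ι → ℝ),
      (∀ g : ℝ → ℂ, IsWeilTest g → Summable fun i => weilMellin g (1 / 2 + (γ i : ℂ) * I)) →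
        ∀ z : ℂ, {i : ι | (1 / 2 : ℂ) + (γ i : ℂ) * I = z}.encard =
          ZetaZeros.riemannZetaNontrivialZeros.indicator
            (fun w => (analyticOrderNatAt riemannZeta w : ℕ∞)) z := by
  intro h
  obtain ⟨ρ, hρ⟩ := nontrivialZeros_nonempty
  have h1 := h PEmpty (fun i => i.elim) (fun g _ => (hasSum_empty (f := fun i : PEmpty =>
    weilMellin g (1 / 2 + ((PEmpty.elim i : ℝ) : ℂ) * I))).summable) ρ
  rw [Set.eq_empty_of_isEmpty {i : PEmpty | (1 / 2 : ℂ) + ((i.elim : ℝ) : ℂ) * I = ρ},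
    Set.encard_empty, Set.indicator_of_mem hρ, eq_comm] at h1
  exact cast_analyticOrderNatAt_ne_zero (ZetaZeros.riemannZetaNontrivialZeros.ne_one hρ)
    (ZetaZeros.riemannZetaNontrivialZeros.zeta_eq_zero hρ) h1

/-! ### Load-bearing: all tests (degenerate windows) -/

/-- **Window rigidity is FALSE for `A ≤ 0`.** Restricting the tests of `SpectralIsHpSpectrum` to
`tsupport g ⊆ [-A, A]` with `A ≤ 0` leaves only `g = 0`, so the junk family `ℕ ↦ 0` satisfies
the hypothesis; its fibre over `z = 1/2` is all of `ℕ` (`encard = ⊤`) while the right-hand side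
is finite. No number theory enters. [folklore] -/
theorem spectralIsHpSpectrum_false_on_window_of_nonpos {A : ℝ} (hA : A ≤ 0) :
    ¬ ∀ (ι : Type) (γ : ι → ℝ),
      (∀ g : ℝ → ℂ, IsWeilTest g → tsupport g ⊆ Icc (-A) A →
        HasSum (fun i => weilMellin g (1 / 2 + (γ i : ℂ) * I)) (weilFunctional g)) →
        ∀ z : ℂ, {i : ι | (1 / 2 : ℂ) + (γ i : ℂ) * I = z}.encard =
          ZetaZeros.riemannZetaNontrivialZeros.indicator
            (fun w => (analyticOrderNatAt riemannZeta w : ℕ∞)) z := by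
  intro h
  have hγ : ∀ g : ℝ → ℂ, IsWeilTest g → tsupport g ⊆ Icc (-A) A →
      HasSum (fun _ : ℕ => weilMellin g (1 / 2 + ((0 : ℝ) : ℂ) * I)) (weilFunctional g) := by
    intro g hg hgs
    have hsupp := support_subset_Ioo_of_tsupport_subset_Icc hg.1.continuous hgs
    rw [Set.Ioo_eq_empty (by linarith : ¬ (-A < A)), Set.subset_empty_iff,
      Function.support_eq_empty_iff] at hsupp
    rw [hsupp, weilFunctional_zero]
    simp only [weilMellin, Pi.zero_apply, zero_mul, integral_zero]
    exact hasSum_zero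
  have h1 := h ℕ (fun _ => 0) hγ (1 / 2)
  have hfib : {i : ℕ | (1 / 2 : ℂ) + (((fun _ : ℕ => (0 : ℝ)) i : ℝ) : ℂ) * I = 1 / 2} = Set.univ := by
    ext n
    simp
  rw [hfib, Set.infinite_univ.encard_eq] at h1
  exact indicator_ne_top _ h1.symm

/-! ### The variant with all zeros -/

/-- **The all-zeros variant of the crux is equivalent to `¬ RH`.** Replacing the non-trivial
zeros by ALL zeros of `ζ` on the right-hand side: (→) under RH the ordinates of the zeros form a
trace family (`hasSum_weilMellin_zeros`, `eq_half_add_of_riemannHypothesis`), whose fibre over the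
trivial zero `-2` is empty while the multiplicity there is `≥ 1`; (←) without RH no trace family
exists (`riemannHypothesis_of_trace`). [folklore] -/
theorem spectralIsHpSpectrumAllZeros_iff_not_riemannHypothesis :
    (∀ (ι : Type) (γ : ι → ℝ),
      (∀ g : ℝ → ℂ, IsWeilTest g →
        HasSum (fun i => weilMellin g (1 / 2 + (γ i : ℂ) * I)) (weilFunctional g)) →
        ∀ z : ℂ, {i : ι | (1 / 2 : ℂ) + (γ i : ℂ) * I = z}.encard =
          riemannZetaZeros.indicator (fun w => (analyticOrderNatAt riemannZeta w : ℕ∞)) z) ↔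
      ¬ _root_.RiemannHypothesis := by
  constructor
  · intro h hRH
    have htr : ∀ g : ℝ → ℂ, IsWeilTest g →
        HasSum (fun p : (Σ ρ : ZetaZeros.riemannZetaNontrivialZeros,
          Fin (riemannZetaZeroOrder (ρ : ℂ)).toNat) =>
            weilMellin g (1 / 2 + (((p.1 : ℂ).im : ℝ) : ℂ) * I)) (weilFunctional g) :=
      fun g hg => by
        simpa only [eq_half_add_of_riemannHypothesis hRH] using hasSum_weilMellin_zeros hg
    have h1 := h _ _ htr (-2)
    have hne1 : (-2 : ℂ) ≠ 1 := by norm_num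
    have hζ : riemannZeta (-2) = 0 := by
      simpa using riemannZeta_neg_two_mul_nat_add_one 0
    have hmem : (-2 : ℂ) ∈ riemannZetaZeros := by
      simpa [riemannZetaZeros] using hζ
    have hfib : {p : (Σ ρ : ZetaZeros.riemannZetaNontrivialZeros,
        Fin (riemannZetaZeroOrder (ρ : ℂ)).toNat) |
          (1 / 2 : ℂ) + (((p.1 : ℂ).im : ℝ) : ℂ) * I = -2} = ∅ := by
      ext p
      simp only [mem_setOf_eq, mem_empty_iff_false, iff_false]
      intro hp
      have := congrArg Complex.re hp
      norm_num at this
    rw [hfib, Set.encard_empty, Set.indicator_of_mem hmem, eq_comm] at h1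
    exact cast_analyticOrderNatAt_ne_zero hne1 hζ h1
  · intro hRH ι γ hγ
    exact absurd (riemannHypothesis_of_trace hγ) hRH

end Summit.RiemannHypothesis.RiemannHypothesis.Theorems.SpectralIsHpSpectrum.Negative

end
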